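import Summits.CriticalPhenomena.Ising3DConformalLimit.Theses.UnitLightCone
import Summits.CriticalPhenomena.Ising3DConformalLimit.Theorems.HyperoctahedralRPTwoPointLimitIsotropicHolds
import Summits.CriticalPhenomena.Ising3DConformalLimit.Theorems.UnitLightConeUnitSpeedTwoPointLaplaceMeasurePowerLaw
import Summits.CriticalPhenomena.Ising3DConformalLimit.Theorems.UnitLightConeUnitSpeedTwoPointSommerfeldWeyl
import Summits.CriticalPhenomena.Ising3DConformalLimit.Theorems.UnitLightConeUnitSpeedTwoPointConePushforward
import HarnessLib

/-!
# Crux `UnitLightCone.UnitSpeedTwoPoint` (item stmt-CriticalPhenomena-17167) — PROOF, line `yukawa_subordination`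
(all stubs landed)

Route `route-CriticalPhenomena-UnitLightCone`, crux (US), rank 2:
`Summit.CriticalPhenomena.Ising3DConformalLimit.Theses.UnitLightCone.UnitSpeedTwoPoint` — for every normalised,
non-degenerate, translation-invariant, scale-covariant pointwise scaling limit `S` of `criticalCorr 3`, the kernel
`x ↦ S 2 (0, x)` has Källén–Lehmann representations in the axis frame `e₂` and in the face-diagonal frame
`(e₀ + e₁)/√2` by positive measures on `ℝ² × ℝ` giving zero mass to the spacelike region `{ω < |k|}` ("speed of
light at least one").

Line lead prover-line-stmt-CriticalPhenomena-17167-0, 2026-08-17 (`Cruxes/UnitSpeedTwoPoint/PICKED.md`; skeleton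
`Cruxes/UnitSpeedTwoPoint/Lines/yukawa_subordination.lean` by planner-cstrat-stmt-CriticalPhenomena-17167-b1-0).

## The line

TREE INPUT (landed, imported): for every admissible limit the kernel `K x = S 2 (0, x)` has `1/2 ≤ Δ ≤ 1`, is
positive off `0` and homogeneous of degree `-2Δ` (`HyperoctahedralRPTwoPoint.twoPointKernelOfLimit_proof`, item
stmt-1983) and is `O(3)`-invariant (`HyperoctahedralRPTwoPoint.kernel_rotation_invariant`, milestone stmt-1984); so
`K = C₀‖x‖^{-2Δ}` off `0`, `C₀ = K e₂ > 0` (`radial_of_isometry_invariant`, Cartan–Dieudonné via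
`Submodule.reflection_sub`), and the crux IS the unit-cone Källén–Lehmann representation of the conformal power kernel,
obtained by MASS SUBORDINATION through the Yukawa family:

* stub A `stub_laplaceMeasurePowerLaw` (`Theorems/UnitLightConeUnitSpeedTwoPointLaplaceMeasurePowerLaw.lean`, p160709):
  the Bernstein measure `ν_Δ` of `r^{1-2Δ}` (`Δ ≥ 1/2`; `δ₀` at the endpoint, `Γ(2Δ-1)⁻¹ m^{2Δ-2} dm` above it);
* stub B `stub_sommerfeldWeyl` (`Theorems/UnitLightConeUnitSpeedTwoPointSommerfeldWeyl.lean`): the Sommerfeld–Weyl mixed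
  representation `∫_{ℝ²} cos(k·w) e^{-Ω|t|} Ω⁻¹ d²k = 2π e^{-mr}/r`, `Ω = √(|k|² + m²)`, by Gaussian subordination
  (helper stubs `stub_besselKHalfLaplace`, `stub_gaussianCosFourierPlane`, `stub_besselKNegHalfLaplace` — p161157,
  p161275, p161158 — and Fubini on `ℝ² × (0,∞)`);
* stub C `stub_conePushforward` (`Theorems/UnitLightConeUnitSpeedTwoPointConePushforward.lean`, p161471): the image of
  `(2πΩ)⁻¹ d²k ⊗ ν` under `(k, m) ↦ (k, Ω)` realises the superposition and charges `{ω < |k|}` with the measure of an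
  EMPTY preimage (`Ω ≥ ‖k‖`) — the unit light cone is automatic.

Composition `UnitSpeedTwoPoint_of` (the registered skeleton's composition, its three stub hypotheses now discharged BY
NAME by the landed stub theorems, so the crux is proved hypothesis-free): `μ := C₀ • μ₀` serves both frames because `K`
is radial — the axis point `a e₀ + b e₁ + t e₂` has norm `√(a² + b² + t²)` and the face-diagonal point
`((t+u)/√2) e₀ + ((t-u)/√2) e₁ + v e₂` has norm `√(u² + v² + t²)`.

Disproof used: none exists for this crux (no `Cruxes/UnitSpeedTwoPoint/Disproof.lean`, no `Negative/*`, 2026-08-17).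
The only failure mode of a unit-cone KL representation of `r^{-2Δ}` — `Δ < 1/2`, below the unitarity bound, not
reflection positive — is excluded by stub A's hypothesis `1/2 ≤ Δ`, supplied by the tree's infrared-bound window.
Sources: Glimm–Jaffe 1987 §6.2 (Källén–Lehmann); Watson, *Bessel Functions* §13.47; Berg–Christensen–Ressel 1984 §4.
-/

noncomputable section

namespace Summit.CriticalPhenomena.Ising3DConformalLimit.Cruxes.UnitSpeedTwoPoint.YukawaSubordination

open MeasureTheory
open Literature.Probability.LatticeModels

/-! ### Sorry-free glue: radial profile, frame geometry, power algebra -/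

/-- **Radial profile (model-blind, proved; replaces `birth`'s stub S1).** A `(-2Δ)`-homogeneous kernel on `ℝ³`
invariant under every linear isometry equals `K e₂ · ‖x‖^{-2Δ}` off the origin: `x = ‖x‖ • u` with `‖u‖ = 1`, and
`K u = K e₂` because the reflection in `(e₂ - u)ᗮ` maps `e₂` to `u` (`Submodule.reflection_sub`, Cartan–Dieudonné;
cf. the landed `SpineGlue.const_on_sphere_of_isometry_invariant`). -/
theorem radial_of_isometry_invariant (Δ : ℝ) (K : EuclideanSpace ℝ (Fin 3) → ℝ)
    (hhom : ∀ c : ℝ, 0 < c → ∀ x, K (c • x) = c ^ (-(2 * Δ)) * K x)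
    (hrot : ∀ (R : EuclideanSpace ℝ (Fin 3) ≃ₗᵢ[ℝ] EuclideanSpace ℝ (Fin 3)) (x : EuclideanSpace ℝ (Fin 3)),
      K (R x) = K x)
    (x : EuclideanSpace ℝ (Fin 3)) (hx : x ≠ 0) :
    K x = K (EuclideanSpace.single 2 1) * ‖x‖ ^ (-(2 * Δ)) := by
  have hn : 0 < ‖x‖ := norm_pos_iff.mpr hx
  set u : EuclideanSpace ℝ (Fin 3) := ‖x‖⁻¹ • x with hu
  have hu1 : ‖u‖ = 1 := by
    rw [hu, norm_smul, norm_inv, norm_norm, inv_mul_cancel₀ hn.ne']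
  have he1 : ‖(EuclideanSpace.single 2 (1 : ℝ) : EuclideanSpace ℝ (Fin 3))‖ = 1 := by simp
  have hxu : x = ‖x‖ • u := by
    rw [hu, smul_smul, mul_inv_cancel₀ hn.ne', one_smul]
  have hKu : K u = K (EuclideanSpace.single 2 1) := by
    have h := Submodule.reflection_sub
      (show ‖(EuclideanSpace.single 2 (1 : ℝ) : EuclideanSpace ℝ (Fin 3))‖ = ‖u‖ by rw [hu1, he1])
    have h2 := hrot ((ℝ ∙ ((EuclideanSpace.single 2 (1 : ℝ) : EuclideanSpace ℝ (Fin 3)) - u))ᗮ.reflection)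
      (EuclideanSpace.single 2 1)
    rw [h] at h2
    exact h2
  calc K x = K (‖x‖ • u) := by rw [← hxu]
    _ = ‖x‖ ^ (-(2 * Δ)) * K u := hhom _ hn u
    _ = K (EuclideanSpace.single 2 1) * ‖x‖ ^ (-(2 * Δ)) := by rw [hKu, mul_comm]

/-- `‖x‖² = x₀² + x₁² + x₂²` on `ℝ³`. -/
private theorem norm_sq_three (x : EuclideanSpace ℝ (Fin 3)) : ‖x‖ ^ 2 = x 0 ^ 2 + x 1 ^ 2 + x 2 ^ 2 := by
  rw [EuclideanSpace.norm_eq, Real.sq_sqrt (by positivity), Fin.sum_univ_three]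
  simp only [Real.norm_eq_abs, sq_abs]

/-- `‖x‖ = √(x₀² + x₁² + x₂²)` on `ℝ³`. -/
private theorem norm_eq_sqrt_three (x : EuclideanSpace ℝ (Fin 3)) :
    ‖x‖ = Real.sqrt (x 0 ^ 2 + x 1 ^ 2 + x 2 ^ 2) := by
  rw [← norm_sq_three, Real.sqrt_sq (norm_nonneg _)]

/-- The axis-frame point `a e₀ + b e₁ + t e₂` has norm `√(a² + b² + t²)` and is nonzero when `t ≠ 0`. -/
theorem axisPoint_norm (a b t : ℝ) :
    ‖(EuclideanSpace.single 0 a + EuclideanSpace.single 1 b + EuclideanSpace.single 2 t :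
        EuclideanSpace ℝ (Fin 3))‖ = Real.sqrt (a ^ 2 + b ^ 2 + t ^ 2) := by
  set p : EuclideanSpace ℝ (Fin 3) :=
    EuclideanSpace.single 0 a + EuclideanSpace.single 1 b + EuclideanSpace.single 2 t with hp
  have h0 : p 0 = a := by simp [hp]
  have h1 : p 1 = b := by simp [hp]
  have h2 : p 2 = t := by simp [hp]
  rw [norm_eq_sqrt_three, h0, h1, h2]

/-- The axis-frame point `a e₀ + b e₁ + t e₂` is nonzero when `t ≠ 0` (its third coordinate is `t`). -/
theorem axisPoint_ne_zero (a b t : ℝ) (ht : t ≠ 0) :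
    (EuclideanSpace.single 0 a + EuclideanSpace.single 1 b + EuclideanSpace.single 2 t :
        EuclideanSpace ℝ (Fin 3)) ≠ 0 := by
  intro h
  have h2 : (EuclideanSpace.single 0 a + EuclideanSpace.single 1 b + EuclideanSpace.single 2 t :
      EuclideanSpace ℝ (Fin 3)) 2 = t := by simp
  rw [h] at h2
  exact ht (by simpa using h2.symm)

/-- The face-diagonal-frame point `((t+u)/√2) e₀ + ((t-u)/√2) e₁ + v e₂` has norm `√(u² + v² + t²)`. -/
theorem diagPoint_norm (t u v : ℝ) :
    ‖(EuclideanSpace.single 0 ((t + u) / Real.sqrt 2) + EuclideanSpace.single 1 ((t - u) / Real.sqrt 2) +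
        EuclideanSpace.single 2 v : EuclideanSpace ℝ (Fin 3))‖ = Real.sqrt (u ^ 2 + v ^ 2 + t ^ 2) := by
  set q : EuclideanSpace ℝ (Fin 3) :=
    EuclideanSpace.single 0 ((t + u) / Real.sqrt 2) + EuclideanSpace.single 1 ((t - u) / Real.sqrt 2) +
      EuclideanSpace.single 2 v with hq
  have h0 : q 0 = (t + u) / Real.sqrt 2 := by simp [hq]
  have h1 : q 1 = (t - u) / Real.sqrt 2 := by simp [hq]
  have h2 : q 2 = v := by simp [hq]
  have hsum : q 0 ^ 2 + q 1 ^ 2 + q 2 ^ 2 = u ^ 2 + v ^ 2 + t ^ 2 := by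
    rw [h0, h1, h2, div_pow, div_pow, Real.sq_sqrt (by norm_num : (0:ℝ) ≤ 2)]
    ring
  rw [norm_eq_sqrt_three, hsum]

/-- The face-diagonal-frame point `((t+u)/√2) e₀ + ((t-u)/√2) e₁ + v e₂` is nonzero when `t ≠ 0`
(its first two coordinates sum to `√2 t`). -/
theorem diagPoint_ne_zero (t u v : ℝ) (ht : t ≠ 0) :
    (EuclideanSpace.single 0 ((t + u) / Real.sqrt 2) + EuclideanSpace.single 1 ((t - u) / Real.sqrt 2) +
        EuclideanSpace.single 2 v : EuclideanSpace ℝ (Fin 3)) ≠ 0 := by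
  intro h
  have hs : Real.sqrt 2 ≠ 0 := by positivity
  have e0 : (EuclideanSpace.single 0 ((t + u) / Real.sqrt 2) + EuclideanSpace.single 1 ((t - u) / Real.sqrt 2) +
      EuclideanSpace.single 2 v : EuclideanSpace ℝ (Fin 3)) 0 = (t + u) / Real.sqrt 2 := by simp
  have e1 : (EuclideanSpace.single 0 ((t + u) / Real.sqrt 2) + EuclideanSpace.single 1 ((t - u) / Real.sqrt 2) +
      EuclideanSpace.single 2 v : EuclideanSpace ℝ (Fin 3)) 1 = (t - u) / Real.sqrt 2 := by simp
  rw [h] at e0 e1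
  have e0' : (t + u) / Real.sqrt 2 = 0 := by simpa using e0.symm
  have e1' : (t - u) / Real.sqrt 2 = 0 := by simpa using e1.symm
  rw [div_eq_zero_iff, or_iff_left hs] at e0' e1'
  exact ht (by linarith)

/-- `r^{1-2Δ}/r = r^{-2Δ}` for `r > 0`. -/
theorem rpow_one_sub_div_self {r : ℝ} (hr : 0 < r) (Δ : ℝ) :
    r ^ (1 - 2 * Δ) / r = r ^ (-(2 * Δ)) := by
  rw [← Real.rpow_sub_one hr.ne']
  congr 1
  ring

/-- The superposition `∫ e^{-mr}/r dν = r^{-2Δ}` once `∫ e^{-mr} dν = r^{1-2Δ}` (`r > 0`). -/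
theorem integral_yukawa_mixture_eq {ν : MeasureTheory.Measure ℝ} {r Δ : ℝ} (hr : 0 < r)
    (h : ∫ m, Real.exp (-(m * r)) ∂ν = r ^ (1 - 2 * Δ)) :
    ∫ m, Real.exp (-(m * r)) / r ∂ν = r ^ (-(2 * Δ)) := by
  rw [MeasureTheory.integral_div, h, rpow_one_sub_div_self hr]

/-! ### The composition (kernel-checked) -/

/-- **`UnitSpeedTwoPoint` — the crux of item stmt-CriticalPhenomena-17167, proved.**  For an admissible limit
`(ρ, Δ, S)`: the kernel `K x = S 2 (0, x)` has `1/2 ≤ Δ ≤ 1`, `K > 0` off `0`, homogeneity `-2Δ`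
(`twoPointKernelOfLimit_proof`, item 1983) and `O(3)`-invariance (`kernel_rotation_invariant`, milestone 1984), all
LANDED; `radial_of_isometry_invariant` makes it `C₀ ‖x‖^{-2Δ}` off `0` with `C₀ = K e₂ > 0`.  Stub A at `Δ` gives the
mass measure `ν`; stub C fed with stub B gives the cone measure `μ₀` of `∫ e^{-mr}/r dν = r^{-2Δ}`; `μ := C₀ • μ₀`
serves both frames since the axis point `a e₀ + b e₁ + t e₂` has norm `√(a² + b² + t²)` and the diagonal point
`((t+u)/√2) e₀ + ((t-u)/√2) e₁ + v e₂` has norm `√(u² + v² + t²)`.  This is the registered skeleton's composition with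
its three stub hypotheses discharged by the landed stub theorems `stub_laplaceMeasurePowerLaw`, `stub_sommerfeldWeyl`,
`stub_conePushforward`. -/
theorem UnitSpeedTwoPoint_of :
    Summit.CriticalPhenomena.Ising3DConformalLimit.Theses.UnitLightCone.UnitSpeedTwoPoint := by
  -- the three landed stubs of the line (A, B, C), by name
  have hA := stub_laplaceMeasurePowerLaw
  have hB := stub_sommerfeldWeyl
  have hC := stub_conePushforward
  intro ρ Δ S hρ hlim _hnorm hnd htr hsc
  -- tree input: window, positivity, homogeneity (item 1983) and O(3)-invariance (milestone 1984)
  obtain ⟨⟨hΔ1, _hΔ2⟩, _hcont, hpos, hhom, _hmirror⟩ :=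
    Summit.CriticalPhenomena.Ising3DConformalLimit.HyperoctahedralRPTwoPoint.twoPointKernelOfLimit_proof
      ρ Δ S hρ hlim hnd htr hsc
  have hrot : ∀ (R : EuclideanSpace ℝ (Fin 3) ≃ₗᵢ[ℝ] EuclideanSpace ℝ (Fin 3)) (x : EuclideanSpace ℝ (Fin 3)),
      (fun q : EuclideanSpace ℝ (Fin 3) => S 2 ![0, q]) (R x) = (fun q => S 2 ![0, q]) x :=
    fun R x =>
      Summit.CriticalPhenomena.Ising3DConformalLimit.HyperoctahedralRPTwoPoint.kernel_rotation_invariant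
        hρ hlim hnd htr hsc R x
  -- radial profile: K x = C₀ ‖x‖^{-2Δ} off 0, C₀ = K e₂ > 0
  set C₀ : ℝ := S 2 ![0, (EuclideanSpace.single 2 (1 : ℝ) : EuclideanSpace ℝ (Fin 3))] with hC₀
  have hK : ∀ x : EuclideanSpace ℝ (Fin 3), x ≠ 0 → S 2 ![0, x] = C₀ * ‖x‖ ^ (-(2 * Δ)) :=
    fun x hx => radial_of_isometry_invariant Δ (fun q => S 2 ![0, q]) hhom hrot x hx
  have hC₀pos : 0 < C₀ := by
    have he : (EuclideanSpace.single 2 (1 : ℝ) : EuclideanSpace ℝ (Fin 3)) ≠ 0 := by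
      intro h
      have h2 : (EuclideanSpace.single 2 (1 : ℝ) : EuclideanSpace ℝ (Fin 3)) 2 = 0 := by rw [h]; rfl
      simp at h2
    exact hpos _ he
  -- stub A: the mass measure ν of r^{1-2Δ}
  obtain ⟨ν, hsf, hν0, hν⟩ := hA Δ hΔ1
  -- stub C fed with stub B: the cone measure of ∫ e^{-mr}/r dν
  obtain ⟨μ₀, hμ₀supp, hμ₀⟩ := hC ν hsf hν0 (fun r hr => (hν r hr).1) hB
  -- scale by C₀
  have hsupp : ((ENNReal.ofReal C₀) • μ₀) {p : EuclideanSpace ℝ (Fin 2) × ℝ | p.2 < ‖p.1‖} = 0 := by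
    rw [Measure.smul_apply, hμ₀supp, smul_zero]
  have hval : ∀ t a b : ℝ, t ≠ 0 →
      ∫ p, Real.cos (p.1 0 * a + p.1 1 * b) * Real.exp (-(p.2 * |t|)) ∂((ENNReal.ofReal C₀) • μ₀) =
        C₀ * Real.sqrt (a ^ 2 + b ^ 2 + t ^ 2) ^ (-(2 * Δ)) := by
    intro t a b ht
    have hr : 0 < Real.sqrt (a ^ 2 + b ^ 2 + t ^ 2) := by
      apply Real.sqrt_pos.2
      have : 0 < t ^ 2 := by positivity
      positivity
    rw [integral_smul_measure, hμ₀ t a b ht, ENNReal.toReal_ofReal hC₀pos.le, smul_eq_mul,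
      integral_yukawa_mixture_eq hr (hν _ hr).2]
  refine ⟨⟨(ENNReal.ofReal C₀) • μ₀, hsupp, fun t a b ht => ?_⟩,
    ⟨(ENNReal.ofReal C₀) • μ₀, hsupp, fun t u v ht => ?_⟩⟩
  · -- axis frame `e₂`
    show S 2 ![0, _] = _
    rw [hK _ (axisPoint_ne_zero a b t ht), axisPoint_norm, hval t a b ht]
  · -- face-diagonal frame `(e₀ + e₁)/√2`
    show S 2 ![0, _] = _
    rw [hK _ (diagPoint_ne_zero t u v ht), diagPoint_norm, hval t u v ht]

end Summit.CriticalPhenomena.Ising3DConformalLimit.Cruxes.UnitSpeedTwoPoint.YukawaSubordination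

end
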